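import Summits.BirchSwinnertonDyer.Rank1Residual.X2.CongruentPartnerAnomalous
import Summits.BirchSwinnertonDyer.Rank1Residual.X11a.TrivialPartner
import HarnessLib

/-!
# Class X11a, route (3d): the split type of `E` at `p` decides the partner's `a_p mod p`
# (cell `b2b-bsdres`, unit `b2b-bsdres-x11a`, gen 24)

HONEST FRAMING (run/shared/lean/b2b/bsd-rank1-residual/, verbatim in every file): the goal of the
cell is to DELETE the COMBINATION-SHAPED residual classes of the Birch–Swinnerton-Dyer formula for
ALL analytic-rank `≤ 1` elliptic curves over `ℚ` — "full BSD formula for every rank `≤ 1` curve in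
class `C`" assembled STRICTLY from published theorems — so that the rank-`≤ 1` remainder becomes
exactly the CONSTRUCTION-SHAPED classes, which are TYPED (missing-input `Prop`s), NOT attempted.
This is not "finishing BSD". Research route; NO CLAIM BEYOND STATED CLASSES. Theorems only; no
definition, no new named fact; nothing booked; no label change.

WHAT. Route (3d) (`X11a/TrivialPartner.lean`, gen 24) transports Mazur's main conjecture with
`μ = 0` from a GOOD ORDINARY `p`-congruent partner `A` of `E` with trivial `p`-primary arithmetic;
one of its certificates is `hna : p ∤ #Ã(𝔽_p)` (`a_p(A) ≢ 1`). The census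
(HOME/b2b-bsdres-x11a/g24/TRIVIAL-PARTNER-CENSUS.md) observed `a_p(A) ≡ a_p(E) (mod p)`: a SPLIT `E`
has only ANOMALOUS partners (no route (3d)), a NON-SPLIT one only NON-ANOMALOUS ones (`hna`
automatic). THIS FILE proves it for EVERY `E[p]`, reducible or not (the X2 seat's
`CongruentPartnerAnomalous` is the reducible case via RATIONAL lines; here the LOCAL line
`X_𝔓 = ker(red ∣ A[p])` of the ordinary partner is used): §2 transports the Tate dichotomies of
`X2/TateLineDecomposition` (`fix_or_quot_of_split`, `not_fix_and_not_quot_of_not_split`, stated for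
`decomp v = D_{𝔓₀}`) to `D_𝔓` for every prime `𝔓 ∣ p` of `\bar ℤ`; §3 shows `X_𝔓` is `D_𝔓`-stable;
§4 proves **`dvd_frobeniusTrace_sub_one_of_equiv_of_split`** (`E` split, `A` good ordinary,
`e : A[p] ≃ E[p]` equivariant ⟹ `p ∣ a_p(A) − 1`) and
**`not_dvd_frobeniusTrace_sub_one_of_equiv_of_not_split`** (`E` non-split ⟹ `p ∤ a_p(A) − 1`); §5
restates them in route-(3d) currency (`p ∣ #Ã(𝔽_p)` at a split pair: (3d) void there;
`p ∤ #Ã(𝔽_p)` at a non-split pair: `bsdp_of_trivialPartner_of_not_split`, `hna` discharged at the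
price of the Tate-uniformisation binder A41). Granted facts: A40/A41 (Silverman ATAEC V.5.3/5.4),
the binders of `X2/TateLineDecomposition`; nothing new.

References: [Serre1972] §1.11; [SilvermanATAEC1994] V.5.3–5.4; [NeukirchANT1999] I §9 (9.4); HOME/b2b-bsdres-x11a/REPORT-g24.md.
-/

noncomputable section

open scoped Classical NumberField Pointwise

open NumberField IsDedekindDomain Field WeierstrassCurve
  Literature.NumberTheory.EllipticCurves Literature.NumberTheory.GaloisRepresentations
  Literature.NumberTheory.EllipticCurves.GreenbergSelmer
  Literature.NumberTheory.EllipticCurves.Rank1Residual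
  Rat.HeightOneSpectrum
  Summit.BirchSwinnertonDyer.Rank1Residual.X2.CongruentPartnerAnomalous

set_option autoImplicit false

namespace Summit.BirchSwinnertonDyer.Rank1Residual.X11a.PartnerSplitType

variable {W A : WeierstrassCurve ℚ} [W.IsElliptic] [W.IsGloballyMinimal] [A.IsElliptic]
  [A.IsGloballyMinimal] {p : ℕ} [hp : Fact p.Prime]

/-! ## §1. Translating a subgroup of `E[p]` by a Galois element -/

omit [W.IsElliptic] [W.IsGloballyMinimal] hp in
/-- Membership in `g • Φ := Φ.map (g • ·)`: `Q ∈ g • Φ ↔ g⁻¹ • Q ∈ Φ`. [folklore] -/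
theorem mem_map_smul_iff (g : absoluteGaloisGroup ℚ) (Φ : AddSubgroup (geomTorsion W (p : ℤ)))
    (Q : geomTorsion W (p : ℤ)) :
    Q ∈ Φ.map (DistribSMul.toAddMonoidHom (geomTorsion W (p : ℤ)) g) ↔ g⁻¹ • Q ∈ Φ := by
  constructor
  · rintro hQ
    obtain ⟨P, hP, rfl⟩ := AddSubgroup.mem_map.mp hQ
    change g⁻¹ • g • P ∈ Φ
    rwa [inv_smul_smul]
  · intro h
    exact AddSubgroup.mem_map.mpr ⟨g⁻¹ • Q, h, by simp [smul_inv_smul]⟩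

omit [W.IsElliptic] [W.IsGloballyMinimal] hp in
/-- `#(g • Φ) = #Φ`. [folklore] -/
theorem card_map_smul (g : absoluteGaloisGroup ℚ) (Φ : AddSubgroup (geomTorsion W (p : ℤ))) :
    Nat.card (Φ.map (DistribSMul.toAddMonoidHom (geomTorsion W (p : ℤ)) g)) = Nat.card Φ :=
  AddSubgroup.card_map_of_injective (MulAction.injective g)

/-! ## §2. The Tate dichotomies at EVERY prime `𝔓 ∣ p` of `\bar ℤ` -/

set_option synthInstance.maxHeartbeats 100000 in
omit [W.IsGloballyMinimal] in
/-- **SPLIT odd `p ‖ N`, any prime `𝔓 ∣ p`: a `D_𝔓`-stable `Φ ≤ E[p]` of order `p` is fixed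
pointwise by `D_𝔓` OR `D_𝔓` is trivial on `E[p]/Φ`** — `TateLineDecomposition.fix_or_quot_of_split`
(for `D_{𝔓₀}`, `𝔓₀ = adicCompletionPrime ℚ v`) moved along `g • 𝔓₀ = 𝔓` to `g⁻¹ • Φ`. Granted A40.
[cite: SilvermanATAEC1994, Ch. V Thm. 3.1 (c),(d) and Thm. 5.3 (a),(b)] [cite: NeukirchANT1999, Ch. I §9 Prop. (9.4)] -/
theorem fix_or_quot_of_split_of_mem_primesAbove (hT : Silverman1994_thmV53_tateUniformisation.{0})
    (hsplit : W.HasSplitMultiplicativeReductionAtPrime p)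
    {v : HeightOneSpectrum (𝓞 ℚ)} (hv : (primesEquiv v : ℕ) = p)
    {𝔓 : Ideal (absIntegers (𝓞 ℚ) ℚ)} (h𝔓 : 𝔓 ∈ v.primesAbove)
    {Φ : AddSubgroup (geomTorsion W (p : ℤ))} (hΦ : Nat.card Φ = p)
    (hΦst : ∀ g ∈ 𝔓.decompositionSubgroup (absoluteGaloisGroup ℚ), ∀ P ∈ Φ, g • P ∈ Φ) :
    (∀ g ∈ 𝔓.decompositionSubgroup (absoluteGaloisGroup ℚ), ∀ P ∈ Φ, g • P = P) ∨
      (∀ g ∈ 𝔓.decompositionSubgroup (absoluteGaloisGroup ℚ), ∀ P : geomTorsion W (p : ℤ),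
        g • P - P ∈ Φ) := by
  have hpv : ((p : ℕ) : 𝓞 ℚ) ∈ v.asIdeal := natCast_mem_asIdeal_of_primesEquiv_eq hv
  have h𝔓₀ := adicCompletionPrime_mem_primesAbove ℚ v
  obtain ⟨g, hg⟩ :=
    HeightOneSpectrum.exists_smul_eq_of_mem_primesAbove_holds (K := ℚ) (v := v) h𝔓₀ h𝔓
  have hg' : g⁻¹ • 𝔓 = adicCompletionPrime ℚ v := by rw [← hg, inv_smul_smul]
  set Φ₀ := Φ.map (DistribSMul.toAddMonoidHom (geomTorsion W (p : ℤ)) g⁻¹) with hΦ₀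
  have hmem₀ : ∀ Q : geomTorsion W (p : ℤ), Q ∈ Φ₀ ↔ g • Q ∈ Φ := fun Q ↦ by
    rw [hΦ₀, mem_map_smul_iff, inv_inv]
  have hΦ₀card : Nat.card Φ₀ = p := by rw [hΦ₀, card_map_smul]; exact hΦ
  have hΦ₀st : ∀ h ∈ decomp (K := ℚ) v, ∀ Q ∈ Φ₀, h • Q ∈ Φ₀ := by
    intro h hh Q hQ
    have hh' := (mem_decompositionSubgroup_adicCompletionPrime_iff v h).mpr hh
    have hconj := conj_mem_decompositionSubgroup_of_smul_eq hg hh'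
    rw [hmem₀] at hQ ⊢
    have h1 := hΦst _ hconj (g • Q) hQ
    rwa [mul_smul, mul_smul, inv_smul_smul] at h1
  rcases X2.TateLineDecomposition.fix_or_quot_of_split W p hT hsplit hpv hΦ₀card hΦ₀st with
    hfix | hquot
  · left
    intro h hh P hP
    have hh₀ := conj_mem_decompositionSubgroup_of_smul_eq hg' hh
    rw [inv_inv] at hh₀
    have hh₀' := (mem_decompositionSubgroup_adicCompletionPrime_iff v _).mp hh₀
    have hP₀ : g⁻¹ • P ∈ Φ₀ := by rw [hmem₀, smul_inv_smul]; exact hP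
    have h1 := hfix _ hh₀' _ hP₀
    rw [mul_smul, mul_smul, smul_inv_smul] at h1
    exact smul_left_cancel g⁻¹ h1
  · right
    intro h hh P
    have hh₀ := conj_mem_decompositionSubgroup_of_smul_eq hg' hh
    rw [inv_inv] at hh₀
    have hh₀' := (mem_decompositionSubgroup_adicCompletionPrime_iff v _).mp hh₀
    have h1 := hquot _ hh₀' (g⁻¹ • P)
    rw [mul_smul, mul_smul, smul_inv_smul, ← smul_sub, hmem₀, smul_inv_smul] at h1
    exact h1

set_option synthInstance.maxHeartbeats 100000 in
/-- **NON-SPLIT odd `p ‖ N`, any prime `𝔓 ∣ p`: no `Φ ≤ E[p]` of order `p` is fixed pointwise by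
`D_𝔓`, and `D_𝔓` is trivial on no `E[p]/Φ`** — `TateLineDecomposition.not_fix_and_not_quot_of_not_split`
moved along `g • 𝔓₀ = 𝔓`. Granted A41. [cite: SilvermanATAEC1994, Ch. V Lemma 5.2 (c), Thm. 5.3, Cor. 5.4]
[cite: NeukirchANT1999, Ch. I §9 Prop. (9.4)] -/
theorem not_fix_and_not_quot_of_not_split_of_mem_primesAbove
    (hT : Silverman1994_thmV53_corV54_tateUniformisation.{0}) (hp2 : p ≠ 2)
    (hmult : W.HasMultiplicativeReductionAtPrime p)
    (hns : ¬ W.HasSplitMultiplicativeReductionAtPrime p)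
    {v : HeightOneSpectrum (𝓞 ℚ)} (hv : (primesEquiv v : ℕ) = p)
    {𝔓 : Ideal (absIntegers (𝓞 ℚ) ℚ)} (h𝔓 : 𝔓 ∈ v.primesAbove)
    {Φ : AddSubgroup (geomTorsion W (p : ℤ))} (hΦ : Nat.card Φ = p) :
    (¬ ∀ g ∈ 𝔓.decompositionSubgroup (absoluteGaloisGroup ℚ), ∀ P ∈ Φ, g • P = P) ∧
      (¬ ∀ g ∈ 𝔓.decompositionSubgroup (absoluteGaloisGroup ℚ), ∀ P : geomTorsion W (p : ℤ),
        g • P - P ∈ Φ) := by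
  have hpv : ((p : ℕ) : 𝓞 ℚ) ∈ v.asIdeal := natCast_mem_asIdeal_of_primesEquiv_eq hv
  have h𝔓₀ := adicCompletionPrime_mem_primesAbove ℚ v
  obtain ⟨g, hg⟩ :=
    HeightOneSpectrum.exists_smul_eq_of_mem_primesAbove_holds (K := ℚ) (v := v) h𝔓₀ h𝔓
  set Φ₀ := Φ.map (DistribSMul.toAddMonoidHom (geomTorsion W (p : ℤ)) g⁻¹) with hΦ₀
  have hmem₀ : ∀ Q : geomTorsion W (p : ℤ), Q ∈ Φ₀ ↔ g • Q ∈ Φ := fun Q ↦ by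
    rw [hΦ₀, mem_map_smul_iff, inv_inv]
  have hΦ₀card : Nat.card Φ₀ = p := by rw [hΦ₀, card_map_smul]; exact hΦ
  obtain ⟨hnfix, hnquot⟩ :=
    X2.TateLineDecomposition.not_fix_and_not_quot_of_not_split W p hT hp2 hmult hns hpv hΦ₀card
  constructor
  · intro hfix
    apply hnfix
    intro h₀ hh₀ Q hQ
    have hh₀' := (mem_decompositionSubgroup_adicCompletionPrime_iff v h₀).mpr hh₀
    have hh := conj_mem_decompositionSubgroup_of_smul_eq hg hh₀'
    have hQ' : g • Q ∈ Φ := (hmem₀ Q).mp hQ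
    have h1 := hfix _ hh _ hQ'
    rw [mul_smul, mul_smul, inv_smul_smul] at h1
    exact smul_left_cancel g h1
  · intro hquot
    apply hnquot
    intro h₀ hh₀ Q
    have hh₀' := (mem_decompositionSubgroup_adicCompletionPrime_iff v h₀).mpr hh₀
    have hh := conj_mem_decompositionSubgroup_of_smul_eq hg hh₀'
    have h1 := hquot _ hh (g • Q)
    rw [mul_smul, mul_smul, inv_smul_smul, ← smul_sub] at h1
    exact (hmem₀ _).mpr h1

/-! ## §3. The kernel of reduction of an ordinary good partner is `D_𝔓`-stable -/

/-- **`X_𝔓 = ker(red ∣ A[p])` is `D_𝔓`-stable** (`p ∤ Δ_A`): modulo `X_𝔓` a Frobenius acts as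
`a_p`, the inertia and `ker ρ̄_{A,p}` trivially, and `G_𝔓 = ⟨φ⟩ I_𝔓 U`
(`exists_eq_frobenius_pow_mul_of_mem_decompositionSubgroup`). [cite: Serre1972, §1.11 (1) and Prop. 11]
[cite: NeukirchANT1999, Ch. I §9 Prop. (9.4)] -/
theorem smul_mem_ker_reduction_of_mem_decompositionSubgroup
    (hΔ : ¬ (p : ℤ) ∣ minimalDiscriminantInt A)
    {𝔓 : Ideal (absIntegers (𝓞 ℚ) ℚ)}
    (hmem : ∀ x : absIntegers (𝓞 ℚ) ℚ, x ∈ 𝔓 ↔ (x : AlgebraicClosure ℚ) ∈ (placeOver p).nonunits)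
    {v : HeightOneSpectrum (𝓞 ℚ)} (hv : (primesEquiv v : ℕ) = p) (h𝔓 : 𝔓 ∈ v.primesAbove)
    {g : absoluteGaloisGroup ℚ} (hg : g ∈ 𝔓.decompositionSubgroup (absoluteGaloisGroup ℚ))
    {P : geomTorsion A (p : ℤ)}
    (hP : P ∈ ((geomReduction hΔ).comp (geomTorsion A (p : ℤ)).subtype).ker) :
    g • P ∈ ((geomReduction hΔ).comp (geomTorsion A (p : ℤ)).subtype).ker := by
  set X := ((geomReduction hΔ).comp (geomTorsion A (p : ℤ)).subtype).ker with hX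
  obtain ⟨σ, hσ⟩ := HeightOneSpectrum.exists_isArithFrobAt_of_mem_primesAbove_holds (K := ℚ)
    (v := v) h𝔓
  have hU : IsOpen ((galoisRepTorsion A (p : ℤ)).ker : Set (absoluteGaloisGroup ℚ)) :=
    isOpen_ker_galoisRepTorsion_holds A (n := (p : ℤ)) (by exact_mod_cast (Fact.out : p.Prime).ne_zero)
  obtain ⟨n, i, u, hi, hu, rfl⟩ :=
    exists_eq_frobenius_pow_mul_of_mem_decompositionSubgroup h𝔓 hσ hU hg
  -- an element acting as a scalar modulo `X` stabilises `X`
  have hstab : ∀ {h : absoluteGaloisGroup ℚ} (c : ℤ),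
      (∀ Q : geomTorsion A (p : ℤ), h • Q - c • Q ∈ X) → ∀ Q ∈ X, h • Q ∈ X := by
    intro h c hc Q hQ
    have h1 := X.add_mem (hc Q) (X.zsmul_mem hQ c)
    rwa [sub_add_cancel] at h1
  have hu' : ∀ Q ∈ X, u • Q ∈ X := fun Q hQ ↦ by
    have h1 : galoisRepTorsion A (p : ℤ) u = 1 := (MonoidHom.mem_ker).mp hu
    have h2 : u • Q = Q := by rw [← galoisRepTorsion_apply, h1]; rfl
    rw [h2]; exact hQ
  have hi' : ∀ Q ∈ X, i • Q ∈ X := hstab 1 fun Q ↦ by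
    rw [one_zsmul]; exact smul_sub_self_mem_ker_of_mem_inertia hΔ hmem hi Q
  have hσ' : ∀ Q ∈ X, σ • Q ∈ X :=
    hstab (A.frobeniusTrace p) fun Q ↦ smul_sub_frobeniusTrace_smul_mem_ker hΔ hmem hv h𝔓 hσ Q
  have hσn : ∀ m : ℕ, ∀ Q ∈ X, (σ ^ m) • Q ∈ X := by
    intro m
    induction m with
    | zero => intro Q hQ; rw [pow_zero, one_smul]; exact hQ
    | succ m ih => intro Q hQ; rw [pow_succ, mul_smul]; exact ih _ (hσ' Q hQ)
  rw [mul_smul, mul_smul]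
  exact hσn n _ (hi' _ (hu' _ hP))

/-! ## §4. The partner's `a_p mod p` is decided by the split type of `E` -/

omit [W.IsGloballyMinimal] in
/-- **SPLIT `E` ⟹ every good-ordinary `p`-congruent partner is ANOMALOUS** (`p` odd; `W[p]`
reducible or not): transport the `D_𝔓`-stable line `X_𝔓 = ker(red ∣ A[p])` (order `p`, §3) to
`Φ = e(X_𝔓) ≤ E[p]`; by the split dichotomy `D_𝔓` fixes `Φ` — impossible, the inertia moves `X_𝔓`
(`exists_mem_inertia_smul_ne_of_mem_ker`) — or is trivial on `E[p]/Φ`, hence on `A[p]/X_𝔓`, so the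
Frobenius fixes `red P ≠ 0` and `a_p(A) ≡ 1` (`dvd_frobeniusTrace_sub_one_of_geomReduction_smul_eq_self`).
Granted A40 (`hT`). [cite: Serre1972, §1.11 (1), Prop. 11 and Cor.]
[cite: SilvermanATAEC1994, Ch. V Thm. 3.1 and Thm. 5.3] -/
theorem dvd_frobeniusTrace_sub_one_of_equiv_of_split
    (hT : Silverman1994_thmV53_tateUniformisation.{0}) (hp2 : p ≠ 2)
    (hsplit : W.HasSplitMultiplicativeReductionAtPrime p)
    (hgoodA : A.HasGoodReductionAtPrime p) (hordA : ¬ (p : ℤ) ∣ A.frobeniusTrace p)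
    (e : geomTorsion A (p : ℤ) ≃+ geomTorsion W (p : ℤ))
    (he : ∀ (σ : absoluteGaloisGroup ℚ) (P : geomTorsion A (p : ℤ)), e (σ • P) = σ • e P) :
    (p : ℤ) ∣ A.frobeniusTrace p - 1 := by
  have hpp := hp.out
  set v : HeightOneSpectrum (𝓞 ℚ) := (Rat.HeightOneSpectrum.primesEquiv).symm ⟨p, hpp⟩ with hvdef
  have hv : (Rat.HeightOneSpectrum.primesEquiv v : ℕ) = p := by
    rw [hvdef, Equiv.apply_symm_apply]
  obtain ⟨𝔓, hmem, h𝔓⟩ := exists_ideal_placeOver p hv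
  haveI : 𝔓.IsPrime := h𝔓.1
  have hΔ : ¬ (p : ℤ) ∣ minimalDiscriminantInt A :=
    A.not_dvd_minimalDiscriminantInt_of_hasGoodReductionAtPrime' p hgoodA
  set X := ((geomReduction hΔ).comp (geomTorsion A (p : ℤ)).subtype).ker with hXdef
  obtain ⟨hXcard, τ, hτ, Q, hQX, hτQ⟩ :=
    exists_mem_inertia_smul_ne_of_mem_ker hp2 hΔ hgoodA hordA hmem hv h𝔓
  -- the image line in `E[p]`, `D_𝔓`-stable of order `p`
  set Φ := X.map e.toAddMonoidHom with hΦdef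
  have hΦcard : Nat.card Φ = p := by
    rw [hΦdef, AddSubgroup.card_map_of_injective e.injective]; exact hXcard
  have hΦst : ∀ g ∈ 𝔓.decompositionSubgroup (absoluteGaloisGroup ℚ), ∀ P ∈ Φ, g • P ∈ Φ := by
    intro g hg P hP
    obtain ⟨R, hR, rfl⟩ := AddSubgroup.mem_map.mp hP
    change g • e R ∈ Φ
    rw [← he]
    exact AddSubgroup.mem_map.mpr
      ⟨g • R, smul_mem_ker_reduction_of_mem_decompositionSubgroup hΔ hmem hv h𝔓 hg hR, rfl⟩
  rcases fix_or_quot_of_split_of_mem_primesAbove hT hsplit hv h𝔓 hΦcard hΦst with hfix | hquot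
  · -- `D_𝔓` fixes `X_𝔓` pointwise: contradicts the inertia
    have hfixA := (forall_fix_map_iff e he (𝔓.decompositionSubgroup (absoluteGaloisGroup ℚ)) X).mp
      hfix
    exact absurd (hfixA τ (𝔓.inertia_le_stabilizer hτ) Q hQX) hτQ
  · -- `D_𝔓` trivial on `A[p]/X_𝔓`: the Frobenius fixes a point of non-zero reduction
    have hquotA := (forall_quot_map_iff e he (𝔓.decompositionSubgroup (absoluteGaloisGroup ℚ)) X).mp
      hquot
    obtain ⟨σ, hσ⟩ := HeightOneSpectrum.exists_isArithFrobAt_of_mem_primesAbove_holds (K := ℚ)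
      (v := v) h𝔓
    have hσD : σ ∈ 𝔓.decompositionSubgroup (absoluteGaloisGroup ℚ) := hσ.mem_stabilizer
    -- a point of `A[p]` outside `X_𝔓` (`#X_𝔓 = p < p² = #A[p]`)
    obtain ⟨P, hPX⟩ : ∃ P : geomTorsion A (p : ℤ), P ∉ X := by
      by_contra hall
      have htop : X = ⊤ := eq_top_iff.mpr fun P _ ↦ by
        by_contra hP
        exact hall ⟨P, hP⟩
      have hc : Nat.card X = p ^ 2 := by
        rw [htop, AddSubgroup.card_top]; exact Rank1Residual.natCard_geomTorsion A p
      rw [hXcard] at hc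
      have : p ^ 1 = p ^ 2 := by rw [pow_one]; exact hc
      exact absurd (Nat.pow_right_injective hpp.two_le this) (by norm_num)
    have hPred : geomReduction hΔ (P : A.geomPoints) ≠ 0 := by
      intro h0
      apply hPX
      rw [hXdef, AddMonoidHom.mem_ker]
      simpa using h0
    have h1 := hquotA σ hσD P
    have hfixP : geomReduction hΔ (σ • (P : A.geomPoints)) = geomReduction hΔ (P : A.geomPoints) := by
      rw [hXdef, AddMonoidHom.mem_ker, map_sub, sub_eq_zero] at h1
      simpa using h1
    exact dvd_frobeniusTrace_sub_one_of_geomReduction_smul_eq_self hΔ hmem hv h𝔓 hσ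
      ((Submodule.mem_torsionBy_iff _ _).mp P.2) hPred hfixP

/-- **NON-SPLIT `E` ⟹ every good-ordinary `p`-congruent partner is NON-ANOMALOUS** (`p` odd):
if `a_p(A) ≡ 1`, `D_𝔓` is trivial on `A[p]/X_𝔓` (`smul_sub_self_mem_ker_of_mem_decompositionSubgroup_of_anom`),
hence on `E[p]/e(X_𝔓)`, contradicting the non-split dichotomy. Granted A41 (`hT`).
[cite: Serre1972, §1.11 (1), Prop. 11 and Cor.] [cite: SilvermanATAEC1994, Ch. V Lemma 5.2 (c), Thm. 5.3, Cor. 5.4] -/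
theorem not_dvd_frobeniusTrace_sub_one_of_equiv_of_not_split
    (hT : Silverman1994_thmV53_corV54_tateUniformisation.{0}) (hp2 : p ≠ 2)
    (hmult : W.HasMultiplicativeReductionAtPrime p)
    (hns : ¬ W.HasSplitMultiplicativeReductionAtPrime p)
    (hgoodA : A.HasGoodReductionAtPrime p) (hordA : ¬ (p : ℤ) ∣ A.frobeniusTrace p)
    (e : geomTorsion A (p : ℤ) ≃+ geomTorsion W (p : ℤ))
    (he : ∀ (σ : absoluteGaloisGroup ℚ) (P : geomTorsion A (p : ℤ)), e (σ • P) = σ • e P) :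
    ¬ (p : ℤ) ∣ A.frobeniusTrace p - 1 := by
  intro ha
  have hpp := hp.out
  set v : HeightOneSpectrum (𝓞 ℚ) := (Rat.HeightOneSpectrum.primesEquiv).symm ⟨p, hpp⟩ with hvdef
  have hv : (Rat.HeightOneSpectrum.primesEquiv v : ℕ) = p := by
    rw [hvdef, Equiv.apply_symm_apply]
  obtain ⟨𝔓, hmem, h𝔓⟩ := exists_ideal_placeOver p hv
  have hΔ : ¬ (p : ℤ) ∣ minimalDiscriminantInt A :=
    A.not_dvd_minimalDiscriminantInt_of_hasGoodReductionAtPrime' p hgoodA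
  set X := ((geomReduction hΔ).comp (geomTorsion A (p : ℤ)).subtype).ker with hXdef
  obtain ⟨hXcard, -⟩ := exists_mem_inertia_smul_ne_of_mem_ker hp2 hΔ hgoodA hordA hmem hv h𝔓
  set Φ := X.map e.toAddMonoidHom with hΦdef
  have hΦcard : Nat.card Φ = p := by
    rw [hΦdef, AddSubgroup.card_map_of_injective e.injective]; exact hXcard
  obtain ⟨-, hnquot⟩ :=
    not_fix_and_not_quot_of_not_split_of_mem_primesAbove hT hp2 hmult hns hv h𝔓 hΦcard
  apply hnquot
  refine (forall_quot_map_iff e he (𝔓.decompositionSubgroup (absoluteGaloisGroup ℚ)) X).mpr ?_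
  intro g hg P
  exact smul_sub_self_mem_ker_of_mem_decompositionSubgroup_of_anom hΔ hmem hv h𝔓 ha hg P

/-! ## §5. Route-(3d) currency: the certificate `p ∤ #Ã(𝔽_p)` -/

omit [A.IsElliptic] hp in
/-- `#Ã(𝔽_p) = p + 1 − a_p(A)` (the definition of the trace of Frobenius, rearranged). [folklore] -/
theorem natCast_reductionPointCount_eq :
    (A.reductionPointCount p : ℤ) = (p : ℤ) + 1 - A.frobeniusTrace p := by
  unfold WeierstrassCurve.frobeniusTrace
  ring

omit [W.IsGloballyMinimal] in
/-- **At a SPLIT pair route (3d) is void**: for `E` split multiplicative at the odd prime `p`, EVERY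
good-ordinary `p`-congruent partner `A` has `p ∣ #Ã(𝔽_p)` — the certificate `hna` of
`X11a.bsdp_of_trivialPartner` fails. Granted A40 (`hT`). [cite: Serre1972, §1.11 (1), Prop. 11] -/
theorem dvd_reductionPointCount_of_equiv_of_split
    (hT : Silverman1994_thmV53_tateUniformisation.{0}) (hp2 : p ≠ 2)
    (hsplit : W.HasSplitMultiplicativeReductionAtPrime p)
    (hgoodA : A.HasGoodReductionAtPrime p) (hordA : ¬ (p : ℤ) ∣ A.frobeniusTrace p)
    (e : geomTorsion A (p : ℤ) ≃+ geomTorsion W (p : ℤ))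
    (he : ∀ (σ : absoluteGaloisGroup ℚ) (P : geomTorsion A (p : ℤ)), e (σ • P) = σ • e P) :
    p ∣ A.reductionPointCount p := by
  obtain ⟨c, hc⟩ := dvd_frobeniusTrace_sub_one_of_equiv_of_split hT hp2 hsplit hgoodA hordA e he
  have h : (A.reductionPointCount p : ℤ) = (p : ℤ) * (1 - c) := by
    rw [natCast_reductionPointCount_eq]; linear_combination (-1 : ℤ) * hc
  exact Int.natCast_dvd_natCast.mp ⟨1 - c, h⟩

/-- **At a NON-SPLIT pair the certificate `hna` is automatic**: for `E` non-split multiplicative at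
the odd prime `p`, every good-ordinary `p`-congruent partner `A` has `p ∤ #Ã(𝔽_p)`. Granted A41
(`hT`). [cite: Serre1972, §1.11 (1), Prop. 11] -/
theorem not_dvd_reductionPointCount_of_equiv_of_not_split
    (hT : Silverman1994_thmV53_corV54_tateUniformisation.{0}) (hp2 : p ≠ 2)
    (hmult : W.HasMultiplicativeReductionAtPrime p)
    (hns : ¬ W.HasSplitMultiplicativeReductionAtPrime p)
    (hgoodA : A.HasGoodReductionAtPrime p) (hordA : ¬ (p : ℤ) ∣ A.frobeniusTrace p)
    (e : geomTorsion A (p : ℤ) ≃+ geomTorsion W (p : ℤ))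
    (he : ∀ (σ : absoluteGaloisGroup ℚ) (P : geomTorsion A (p : ℤ)), e (σ • P) = σ • e P) :
    ¬ p ∣ A.reductionPointCount p := by
  intro hdvd
  apply not_dvd_frobeniusTrace_sub_one_of_equiv_of_not_split hT hp2 hmult hns hgoodA hordA e he
  obtain ⟨c, hc⟩ := Int.natCast_dvd_natCast.mpr hdvd
  refine ⟨1 - (c : ℤ), ?_⟩
  have h := natCast_reductionPointCount_eq (A := A) (p := p)
  rw [hc] at h
  linear_combination h

/-- **Route (3d) at a NON-SPLIT X11a pair with `hna` discharged**: `X11a.bsdp_of_trivialPartner`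
with `hna` replaced by `¬ split` (plus the Tate-uniformisation fact A41 `hT`); other inputs as there.
Nothing booked. [cite: EmertonPollackWeston2006, Cor. 5.1.4 (arXiv:math/0404484 p. 30)]
[cite: SilvermanATAEC1994, Ch. V Lemma 5.2 (c), Thm. 5.3, Cor. 5.4] -/
theorem bsdp_of_trivialPartner_of_not_split (W A : WeierstrassCurve ℚ) [W.IsElliptic]
    [W.IsGloballyMinimal] [A.IsElliptic] [A.IsGloballyMinimal] (p : ℕ) [Fact p.Prime]
    (hNf : ModularForms.exists_isNewformOf)
    (hT : Silverman1994_thmV53_corV54_tateUniformisation.{0})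
    (hBCS : burungale_castella_skinner_charIdeal_eq_padicLFunction)
    (hGr : greenberg_charValue_rankZero) (hΩ : realPeriodRat_eq_unit_mul_plusPeriod)
    (hEPW : EmertonPollackWeston2006.cor514_transfer_of_goodOrdinary)
    (hJs : SteinWuthrich2013.thm61_splitMultiplicative)
    (hJn : SteinWuthrich2013.thm61_nonsplitMultiplicative)
    (hGZK : rank_eq_analyticRank_of_analyticRank_le_one)
    (hGS : greenberg_stevens (W := W) (p := p))
    (hX : ClassX11a W p) (h5 : 5 ≤ p) (hns : ¬ W.HasSplitMultiplicativeReductionAtPrime p)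
    (hgoodA : A.HasGoodReductionAtPrime p) (hordA : ¬ (p : ℤ) ∣ A.frobeniusTrace p)
    (htam : ¬ p ∣ A.tamagawaProduct)
    (hL : ∃ q : ℚ, q ≠ 0 ∧ A.entireLFunction 1 / (A.realPeriodRat : ℂ) = (q : ℂ) ∧ padicValRat p q = 0)
    (hSel : Nat.card (A.selmerGroupPInfty p) = 1)
    (hC1 : ∃ e : geomTorsion A (p : ℤ) ≃+ geomTorsion W (p : ℤ),
      ∀ (σ : absoluteGaloisGroup ℚ) (P : geomTorsion A (p : ℤ)), e (σ • P) = σ • e P) :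
    BSDp W p := by
  obtain ⟨e, he⟩ := hC1
  have hp2 : p ≠ 2 := by omega
  have hna : ¬ p ∣ A.reductionPointCount p :=
    not_dvd_reductionPointCount_of_equiv_of_not_split hT hp2 hX.mult hns hgoodA hordA e he
  exact X11a.bsdp_of_trivialPartner W A p hNf hBCS hGr hΩ hEPW hJs hJn hGZK hGS hX h5 hgoodA hordA hna
    htam hL hSel ⟨e, he⟩

end Summit.BirchSwinnertonDyer.Rank1Residual.X11a.PartnerSplitType

end
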